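import Literature.MathematicalPhysics.QuantumFieldTheory.PeriodicBoxRotation
import HarnessLib

/-!
# Rooting of small clusters on the periodic box: the factor of the volume

Sequel of `PeriodicBoxRotation`. In the strong-coupling cluster expansion of `log Z` of the Wilson
theory on the anisotropic periodic box of sizes `n` (`PeriodicBoxPlaqSystem`,
`PlaqSystemClusterExpansion`), the families of polymers of total size `< m` are too small to wrap
around a direction `i` with `2m ≤ nᵢ`; modulo the translations in the `i`-th direction each nonempty
cluster has a unique ROOTED representative (`BoxRooted i m`: all `i`-th coordinates `< m`, some
equal to `0`):

* `isRConnected_biUnion_of_isPolymerCluster`: the support of a cluster of connected polymers is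
  connected; `exists_mem_pred_not_mem`: a proper subset of `ℤ/k` has a start;
  `BoxLabel.coord_eq_or_of_not_disjoint`: labels sharing a bond have cyclically adjacent coordinates;
* `exists_boxRooted_rotFamily` / `eq_of_rotFamily_eq_of_boxRooted`: existence and uniqueness of the
  rooting translation of a nonempty cluster of size `< m`;
* `sum_small_eq_size_mul_sum_boxRooted`: hence, for any translation-invariant property `Q`,
  `Σ_{‖𝒞‖ < m, Q} Φ^T(𝒞) = nᵢ · Σ_{‖𝒞‖ < m, Q, rooted in i} Φ^T(𝒞)` on the strong-coupling disc (the
  non-clusters do not contribute, [KP86]) — the extensivity of the small-cluster part of `log Z`.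

Everything is proved; no named facts; no new definitions.

## References

* E. Seiler, LNP 159 (1982), Ch. 2–3 (periodic boundary conditions; the strong-coupling
  expansion of the free energy). [SeilerLNP1982]
* R. Kotecký, D. Preiss, Comm. Math. Phys. 103 (1986) 491–498, Theorem p. 492. [KoteckyPreiss1986]
-/

noncomputable section
namespace Literature.MathematicalPhysics.QuantumFieldTheory

open MeasureTheory Finset
open Literature.Probability.LatticeModels

/-! ### The support of a cluster of connected polymers is connected -/

/-- **The support of a cluster of connected polymers is connected**: if every member of the
nonempty family `𝒞` is a nonempty `R`-connected set and `𝒞` is a cluster for the geometric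
incompatibility, then `⋃ 𝒞` is `R`-connected. [folklore] -/
theorem isRConnected_biUnion_of_isPolymerCluster {V : Type*} [DecidableEq V] {R : V → V → Prop}
    {𝒞 : Finset (Finset V)} (hcl : IsPolymerCluster (GeomInc R) 𝒞) (hconn : ∀ Y ∈ 𝒞, IsRConnected R Y)
    (hne : 𝒞.Nonempty) : IsRConnected R (𝒞.biUnion id) := by
  classical
  set X := 𝒞.biUnion id with hX
  have hYX : ∀ Y ∈ 𝒞, Y ⊆ X := fun Y hY => Finset.subset_biUnion_of_mem id hY
  -- chains inside a member are chains inside the support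
  have hin : ∀ Y ∈ 𝒞, ∀ a b, Relation.ReflTransGen (fun x y => R x y ∧ x ∈ Y ∧ y ∈ Y) a b →
      Relation.ReflTransGen (fun x y => R x y ∧ x ∈ X ∧ y ∈ X) a b := fun Y hY a b h =>
    Relation.ReflTransGen.mono (fun x y (hxy : R x y ∧ x ∈ Y ∧ y ∈ Y) =>
      (⟨hxy.1, hYX Y hY hxy.2.1, hYX Y hY hxy.2.2⟩ : R x y ∧ x ∈ X ∧ y ∈ X)) _ _ h
  refine ⟨?_, fun v hv w hw => ?_⟩
  · obtain ⟨Y, hY⟩ := hne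
    obtain ⟨y, hy⟩ := (hconn Y hY).1
    exact ⟨y, hYX Y hY hy⟩
  -- the members reachable from `v` form all of `𝒞`
  set C₁ := 𝒞.filter fun Y => ∃ u ∈ Y, Relation.ReflTransGen (fun x y => R x y ∧ x ∈ X ∧ y ∈ X) v u
    with hC₁
  obtain ⟨Y₁, hY₁, hvY₁⟩ : ∃ Y₁ ∈ 𝒞, v ∈ Y₁ := by simpa [hX] using hv
  have hC₁eq : C₁ = 𝒞 := by
    by_contra hneq
    have hsub : C₁ ⊆ 𝒞 := Finset.filter_subset _ _
    have hne₁ : C₁.Nonempty := ⟨Y₁, Finset.mem_filter.2 ⟨hY₁, v, hvY₁, Relation.ReflTransGen.refl⟩⟩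
    have hne₂ : (𝒞 \ C₁).Nonempty := by
      rw [Finset.sdiff_nonempty]
      exact fun h => hneq (Finset.Subset.antisymm hsub h)
    obtain ⟨Y, hY, Y', hY', hinc⟩ := hcl C₁ hsub hne₁ hne₂
    obtain ⟨hY𝒞, u, hu, hvu⟩ := Finset.mem_filter.1 hY
    obtain ⟨hY'𝒞, hY'C₁⟩ := Finset.mem_sdiff.1 hY'
    apply hY'C₁
    rcases hinc with rfl | ⟨a, ha, b, hb, hab⟩
    · exact hY
    · refine Finset.mem_filter.2 ⟨hY'𝒞, b, hb, ?_⟩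
      have hva : Relation.ReflTransGen (fun x y => R x y ∧ x ∈ X ∧ y ∈ X) v a :=
        hvu.trans (hin Y hY𝒞 u a ((hconn Y hY𝒞).2 u hu a ha))
      rcases hab with rfl | hab
      · exact hva
      · exact hva.tail ⟨hab, hYX Y hY𝒞 ha, hYX Y' hY'𝒞 hb⟩
  obtain ⟨Y₂, hY₂, hwY₂⟩ : ∃ Y₂ ∈ 𝒞, w ∈ Y₂ := by simpa [hX] using hw
  have hY₂C : Y₂ ∈ C₁ := hC₁eq ▸ hY₂
  obtain ⟨-, u, hu, hvu⟩ := Finset.mem_filter.1 hY₂C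
  exact hvu.trans (hin Y₂ hY₂ u w ((hconn Y₂ hY₂).2 u hu w hwY₂))

/-- The support of a family of polymers is at most as large as its total size. [folklore] -/
theorem card_biUnion_le_sum_card_real {V : Type*} [DecidableEq V] (𝒞 : Finset (Finset V)) :
    ((𝒞.biUnion id).card : ℝ) ≤ ∑ Y ∈ 𝒞, (Y.card : ℝ) := by
  have h : (𝒞.biUnion id).card ≤ ∑ Y ∈ 𝒞, (id Y).card := Finset.card_biUnion_le
  exact_mod_cast h

/-! ### Cyclic arithmetic -/

/-- The cyclic successor below `k`. [folklore] -/
theorem succ_mod_eq_ite {k c : ℕ} (hc : c < k) : (c + 1) % k = if c + 1 = k then 0 else c + 1 := by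
  split_ifs with h
  · rw [h, Nat.mod_self]
  · exact Nat.mod_eq_of_lt (by omega)

/-- The shifted coordinate `(c + k - s) mod k` in closed form. [folklore] -/
theorem add_sub_mod_eq_ite {k s c : ℕ} (hs : s < k) (hc : c < k) :
    (c + k - s) % k = if s ≤ c then c - s else c + k - s := by
  split_ifs with h
  · rw [show c + k - s = (c - s) + k by omega, Nat.add_mod_right, Nat.mod_eq_of_lt (by omega)]
  · exact Nat.mod_eq_of_lt (by omega)

/-- **A proper subset of `{0, …, k-1}` has a start**: an element whose cyclic predecessor is
missing (otherwise the set is closed under cyclic predecessors and exhausts `{0, …, k-1}`).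
[folklore] -/
theorem exists_mem_pred_not_mem {k : ℕ} {K : Finset ℕ} (hK : ∀ c ∈ K, c < k) (hne : K.Nonempty)
    (hcard : K.card < k) : ∃ s ∈ K, (s + k - 1) % k ∉ K := by
  by_contra hcon
  push Not at hcon
  obtain ⟨s₀, hs₀⟩ := hne
  have hk : 0 < k := lt_of_le_of_lt (Nat.zero_le _) hcard
  -- going down from `s₀` to `0`
  have hdown : ∀ j, j ≤ s₀ → s₀ - j ∈ K := by
    intro j hj
    induction j with
    | zero => simpa using hs₀
    | succ j ih =>
      have h := hcon _ (ih (Nat.le_of_succ_le hj))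
      have hlt : s₀ - j < k := hK _ (ih (Nat.le_of_succ_le hj))
      have e : (s₀ - j + k - 1) % k = s₀ - (j + 1) := by
        rw [show s₀ - j + k - 1 = (s₀ - (j + 1)) + k by omega, Nat.add_mod_right,
          Nat.mod_eq_of_lt (by omega)]
      rwa [e] at h
  have h0 : 0 ∈ K := by simpa using hdown s₀ le_rfl
  -- wrapping around: from `0` to `k - 1`, then down to everything
  have htop : k - 1 ∈ K := by
    have h := hcon 0 h0
    rwa [Nat.zero_add, Nat.mod_eq_of_lt (Nat.sub_lt hk one_pos)] at h
  have hall : ∀ j, j ≤ k - 1 → k - 1 - j ∈ K := by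
    intro j hj
    induction j with
    | zero => simpa using htop
    | succ j ih =>
      have h := hcon _ (ih (Nat.le_of_succ_le hj))
      have e : (k - 1 - j + k - 1) % k = k - 1 - (j + 1) := by
        rw [show k - 1 - j + k - 1 = (k - 1 - (j + 1)) + k by omega, Nat.add_mod_right,
          Nat.mod_eq_of_lt (by omega)]
      rwa [e] at h
  have hsub : Finset.range k ⊆ K := by
    intro c hc
    rw [Finset.mem_range] at hc
    have := hall (k - 1 - c) (by omega)
    rwa [show k - 1 - (k - 1 - c) = c by omega] at this
  have := Finset.card_le_card hsub
  rw [Finset.card_range] at this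
  omega

/-! ### Coordinates of adjacent labels -/

variable {d : ℕ} {n : Fin d → ℕ}

namespace BoxLabel

/-- The `i`-th coordinate of a shifted site is the coordinate or its cyclic successor. [folklore] -/
theorem val_shift_apply_eq_or (μ i : Fin d) (x : BoxSite n) :
    ((BoxSite.shift μ x i : Fin (n i)) : ℕ) = (x i : ℕ) ∨
      ((BoxSite.shift μ x i : Fin (n i)) : ℕ) = ((x i : ℕ) + 1) % n i := by
  by_cases h : i = μ
  · subst h
    right
    have hn : 0 < n i := Fin.pos (x i)
    simp only [BoxSite.shift, Function.update_self,
      Literature.GroupTheory.CombinatorialGroupTheory.val_finRotate hn]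
  · left
    simp only [BoxSite.shift, Function.update_of_ne h]

/-- The `i`-th coordinate of the base of a bond of the label `p` is `coord i p` or its cyclic
successor. [folklore] -/
theorem coord_of_toEdge_mem_bonds {y : BoxSite n} {μ : Fin d} {p : BoxLabel n} (h : BoxSite.toEdge y μ ∈ p.bonds)
    (i : Fin d) : (y i : ℕ) = coord i p ∨ (y i : ℕ) = (coord i p + 1) % n i := by
  simp only [bonds, Finset.mem_insert, Finset.mem_singleton, BoxSite.toEdge_inj] at h
  rcases h with ⟨rfl, -⟩ | ⟨rfl, -⟩ | ⟨rfl, -⟩ | ⟨rfl, -⟩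
  · exact Or.inl rfl
  · exact val_shift_apply_eq_or _ i p.1
  · exact val_shift_apply_eq_or _ i p.1
  · exact Or.inl rfl

/-- **Adjacent labels have cyclically adjacent coordinates**: if `p` and `q` share a bond then
`coord i q` is `coord i p`, its cyclic successor or its cyclic predecessor. [folklore] -/
theorem coord_eq_or_of_not_disjoint {p q : BoxLabel n} (h : ¬ Disjoint p.bonds q.bonds) (i : Fin d) :
    coord i q = coord i p ∨ coord i q = (coord i p + 1) % n i ∨ coord i p = (coord i q + 1) % n i := by
  obtain ⟨e, hep, heq⟩ := Finset.not_disjoint_iff.1 h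
  obtain ⟨y, μ, rfl⟩ := exists_eq_toEdge_of_mem_bonds hep
  have hp := coord_lt i p
  have hq := coord_lt i q
  rw [succ_mod_eq_ite hp, succ_mod_eq_ite hq]
  rcases coord_of_toEdge_mem_bonds hep i with h1 | h1 <;>
    rcases coord_of_toEdge_mem_bonds heq i with h2 | h2
  all_goals
    rw [h1] at h2
    try simp only [succ_mod_eq_ite hp, succ_mod_eq_ite hq] at h2
    split_ifs at * <;> omega

end BoxLabel

/-! ### The rooting rotation of a small cluster -/

section Rooting

variable {G : Type*} [Group G] {N : ℕ} {ρ : G →* Matrix (Fin N) (Fin N) ℂ}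

/-- **Existence of the rooting rotation.** Let `𝒞` be a nonempty cluster (for the geometric
incompatibility of the box system) of nonempty connected label sets of total size `< m`. Then
some rotation in the `i`-th coordinate roots it: there is `s < nᵢ` such that `rot i (nᵢ - s) 𝒞`
has all `i`-th coordinates `< m` and attains `0` (the support is connected, its `i`-th coordinates
form a cyclic arc with fewer than `nᵢ` points, whose start `s` is moved to `0`; along the connected
support the shifted coordinate grows by at most one per step, so it stays below the size of the
support). [folklore] -/
theorem exists_boxRooted_rotFamily (i : Fin d) {m : ℕ} (hmn : m ≤ n i) {𝒞 : Finset (Finset (BoxLabel n))}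
    (hne : 𝒞.Nonempty) (hcl : IsPolymerCluster (GeomInc (boxSystem (G := G) ρ n).Adj) 𝒞)
    (hconn : ∀ Y ∈ 𝒞, IsRConnected (boxSystem (G := G) ρ n).Adj Y) (hsize : ∑ Y ∈ 𝒞, (Y.card : ℝ) < m) :
    ∃ s, s < n i ∧ BoxRooted i m (𝒞.image (Finset.image (BoxLabel.rot i (n i - s)))) := by
  classical
  set X := 𝒞.biUnion id with hX
  set K := X.image (BoxLabel.coord i) with hK
  have hXconn : IsRConnected (boxSystem (G := G) ρ n).Adj X :=
    isRConnected_biUnion_of_isPolymerCluster hcl hconn hne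
  -- sizes
  have hXcard : (X.card : ℝ) < m := (card_biUnion_le_sum_card_real 𝒞).trans_lt hsize
  have hXm : X.card < m := by exact_mod_cast hXcard
  have hKcard : K.card < n i := Finset.card_image_le.trans_lt (by omega)
  have hKlt : ∀ c ∈ K, c < n i := by
    intro c hc
    obtain ⟨p, -, rfl⟩ := Finset.mem_image.1 hc
    exact BoxLabel.coord_lt i p
  have hKne : K.Nonempty := hXconn.1.image _
  -- the start of the arc and the root label
  obtain ⟨s, hsK, hpred⟩ := exists_mem_pred_not_mem hKlt hKne hKcard
  have hs : s < n i := hKlt s hsK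
  obtain ⟨p₀, hp₀X, hp₀s⟩ := Finset.mem_image.1 hsK
  refine ⟨s, hs, ?_⟩
  -- the shifted coordinate
  set δ : BoxLabel n → ℕ := fun p => (BoxLabel.coord i p + n i - s) % n i with hδ
  have hδform : ∀ p : BoxLabel n, δ p = if s ≤ BoxLabel.coord i p then BoxLabel.coord i p - s
      else BoxLabel.coord i p + n i - s := fun p => add_sub_mod_eq_ite hs (BoxLabel.coord_lt i p)
  have hδroot : δ p₀ = 0 := by rw [hδform, hp₀s]; simp
  -- the restricted adjacency on the support and its Lipschitz property
  set adj : BoxLabel n → BoxLabel n → Prop := fun u v => (boxSystem (G := G) ρ n).Adj u v ∧ u ∈ X ∧ v ∈ X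
    with hadj
  have hlip : ∀ u v, adj u v → δ v ≤ δ u + 1 := by
    rintro u v ⟨huv, -, hvX⟩
    have hu := BoxLabel.coord_lt i u
    have hv := BoxLabel.coord_lt i v
    have hvK : BoxLabel.coord i v ∈ K := Finset.mem_image.2 ⟨v, hvX, rfl⟩
    -- the missing predecessor of `s`, in closed form
    have hmiss : (if s = 0 then n i - 1 else s - 1) ∉ K := by
      have e : (s + n i - 1) % n i = if s = 0 then n i - 1 else s - 1 := by
        split_ifs with h0
        · rw [h0, Nat.zero_add, Nat.mod_eq_of_lt (by omega)]
        · rw [show s + n i - 1 = (s - 1) + n i by omega, Nat.add_mod_right, Nat.mod_eq_of_lt (by omega)]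
      rw [← e]; exact hpred
    have hne' : BoxLabel.coord i v ≠ (if s = 0 then n i - 1 else s - 1) := fun h => hmiss (h ▸ hvK)
    rw [hδform, hδform]
    rcases BoxLabel.coord_eq_or_of_not_disjoint huv i with h | h | h
    · rw [h]; split_ifs <;> omega
    · rw [succ_mod_eq_ite hu] at h
      split_ifs at * <;> omega
    · rw [succ_mod_eq_ite hv] at h
      split_ifs at * <;> omega
  -- connectedness of the support for the restricted adjacency, rooted at `p₀`
  have hconnX : Polymer.IsConn adj X p₀ := by
    refine ⟨hp₀X, fun b hb => ?_⟩
    rw [Polymer.reach_iff]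
    exact Relation.ReflTransGen.mono (fun x y (hxy : (boxSystem (G := G) ρ n).Adj x y ∧ x ∈ X ∧ y ∈ X) =>
      (⟨hxy.2.1, hxy.2.2, hxy.1, hxy.2.1, hxy.2.2⟩ : Polymer.AdjIn adj X x y)) _ _ (hXconn.2 p₀ hp₀X b hb)
  have hδlt : ∀ b ∈ X, δ b < m := fun b hb =>
    lt_of_le_of_lt (hconnX.le_card_sub_one δ hδroot hlip hb) (by
      have : 0 < X.card := Finset.card_pos.2 ⟨b, hb⟩
      omega)
  -- rootedness of the rotated family
  have hcoord : ∀ p : BoxLabel n, BoxLabel.coord i (BoxLabel.rot i (n i - s) p) = δ p := by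
    intro p
    rw [BoxLabel.coord_rot_self, hδ]
    congr 1
    omega
  refine ⟨fun Y' hY' p' hp' => ?_, ?_⟩
  · obtain ⟨Y, hY, rfl⟩ := Finset.mem_image.1 hY'
    obtain ⟨p, hp, rfl⟩ := Finset.mem_image.1 hp'
    rw [hcoord]
    exact hδlt p (Finset.mem_biUnion.2 ⟨Y, hY, hp⟩)
  · obtain ⟨Y₀, hY₀, hp₀Y₀⟩ := Finset.mem_biUnion.1 hp₀X
    exact ⟨Y₀.image (BoxLabel.rot i (n i - s)), Finset.mem_image_of_mem _ hY₀, BoxLabel.rot i (n i - s) p₀,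
      Finset.mem_image_of_mem _ hp₀Y₀, by rw [hcoord, hδroot]⟩

/-- **Uniqueness of the rooting rotation**: two rooted families at scale `m` with `2m ≤ nᵢ` whose
rotations by `s, s' < nᵢ` coincide have `s = s'` (the value `0` of one family lands on `s`, which
must be within `m` of `s'` cyclically, and vice versa; `2m ≤ nᵢ` leaves no room). [folklore] -/
theorem eq_of_rotFamily_eq_of_boxRooted (i : Fin d) {m : ℕ} (hm : 2 * m ≤ n i)
    {𝒞 𝒞' : Finset (Finset (BoxLabel n))} (h𝒞 : BoxRooted i m 𝒞) (h𝒞' : BoxRooted i m 𝒞')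
    {s s' : ℕ} (hs : s < n i) (hs' : s' < n i)
    (heq : 𝒞.image (Finset.image (BoxLabel.rot i s)) = 𝒞'.image (Finset.image (BoxLabel.rot i s'))) : s = s' := by
  classical
  -- the coordinates of the common rotated family, from both sides
  have hmem : ∀ {𝒟 : Finset (Finset (BoxLabel n))} {t : ℕ} {c : ℕ},
      (∃ Y ∈ 𝒟.image (Finset.image (BoxLabel.rot i t)), ∃ p ∈ Y, BoxLabel.coord i p = c) ↔
        ∃ Y ∈ 𝒟, ∃ p ∈ Y, (BoxLabel.coord i p + t) % n i = c := by
    intro 𝒟 t c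
    constructor
    · rintro ⟨Y', hY', p', hp', rfl⟩
      obtain ⟨Y, hY, rfl⟩ := Finset.mem_image.1 hY'
      obtain ⟨p, hp, rfl⟩ := Finset.mem_image.1 hp'
      exact ⟨Y, hY, p, hp, (BoxLabel.coord_rot_self i t p).symm⟩
    · rintro ⟨Y, hY, p, hp, rfl⟩
      exact ⟨Y.image (BoxLabel.rot i t), Finset.mem_image_of_mem _ hY, BoxLabel.rot i t p,
        Finset.mem_image_of_mem _ hp, BoxLabel.coord_rot_self i t p⟩
  obtain ⟨h1, Y₀, hY₀, p₀, hp₀, h0⟩ := h𝒞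
  obtain ⟨h1', Y₀', hY₀', p₀', hp₀', h0'⟩ := h𝒞'
  -- `s` is a coordinate of the common family, hence `(c' + s') % n` for some `c' < m`
  have hsmem : ∃ Y ∈ 𝒞', ∃ p ∈ Y, (BoxLabel.coord i p + s') % n i = s := by
    rw [← hmem, ← heq, hmem]
    exact ⟨Y₀, hY₀, p₀, hp₀, by rw [h0, Nat.zero_add, Nat.mod_eq_of_lt hs]⟩
  have hs'mem : ∃ Y ∈ 𝒞, ∃ p ∈ Y, (BoxLabel.coord i p + s) % n i = s' := by
    rw [← hmem, heq, hmem]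
    exact ⟨Y₀', hY₀', p₀', hp₀', by rw [h0', Nat.zero_add, Nat.mod_eq_of_lt hs']⟩
  obtain ⟨Y, hY, p, hp, hc⟩ := hsmem
  obtain ⟨Y', hY', p', hp', hc'⟩ := hs'mem
  have hcm := h1' Y hY p hp
  have hcm' := h1 Y' hY' p' hp'
  -- elementary arithmetic: c + s' ≡ s and c' + s ≡ s' with c, c' < m ≤ n/2 forces c = c' = 0
  rcases Nat.lt_or_ge (BoxLabel.coord i p + s') (n i) with ha | ha <;>
    rcases Nat.lt_or_ge (BoxLabel.coord i p' + s) (n i) with hb | hb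
  · rw [Nat.mod_eq_of_lt ha] at hc; rw [Nat.mod_eq_of_lt hb] at hc'; omega
  · rw [Nat.mod_eq_of_lt ha] at hc
    rw [show BoxLabel.coord i p' + s = (BoxLabel.coord i p' + s - n i) + n i by omega, Nat.add_mod_right,
      Nat.mod_eq_of_lt (by omega)] at hc'
    omega
  · rw [Nat.mod_eq_of_lt hb] at hc'
    rw [show BoxLabel.coord i p + s' = (BoxLabel.coord i p + s' - n i) + n i by omega, Nat.add_mod_right,
      Nat.mod_eq_of_lt (by omega)] at hc
    omega
  · rw [show BoxLabel.coord i p' + s = (BoxLabel.coord i p' + s - n i) + n i by omega, Nat.add_mod_right,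
      Nat.mod_eq_of_lt (by omega)] at hc'
    rw [show BoxLabel.coord i p + s' = (BoxLabel.coord i p + s' - n i) + n i by omega, Nat.add_mod_right,
      Nat.mod_eq_of_lt (by omega)] at hc
    omega

end Rooting

/-! ### Small clusters are the rotations of the rooted ones: the factor `nᵢ` -/

section SumIdentity

variable {G : Type*} [Group G] {N : ℕ} {ρ : G →* Matrix (Fin N) (Fin N) ℂ}
  [TopologicalSpace G] [IsTopologicalGroup G] [CompactSpace G] [MeasurableSpace G] [BorelSpace G]

open scoped Classical in
/-- **Translation invariance of the small-cluster sum: the factor `nᵢ`.** On the strong-coupling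
disc, for `2m ≤ nᵢ` and any property `Q` of finite families of polymers invariant under the
rotations in the `i`-th coordinate, the truncated functionals of the families of polymers of the
periodic box of total size `< m` satisfying `Q` sum to `nᵢ` times the sum over those which are
moreover ROOTED in the `i`-th coordinate (`BoxRooted i m`): the non-cluster and empty families do
not contribute ([KP86]: `Φ^T` vanishes off clusters), and the nonempty clusters of size `< m`
satisfying `Q` are, bijectively, the `nᵢ` rotations of the rooted ones
(`exists_boxRooted_rotFamily`, `eq_of_rotFamily_eq_of_boxRooted`), with equal truncated functional
(`truncatedWeight_rotFamily`). This is the extensivity step of the strong-coupling expansion of the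
free energy on a periodic box. [cite: SeilerLNP1982, Ch. 2] -/
theorem sum_small_eq_size_mul_sum_boxRooted (hρ : Continuous ρ) {β : ℂ} (hβ : ‖β‖ * costBound ρ ≤ 1)
    (hsmall : Real.exp 1 * (2 * costBound ρ * ‖β‖) * ((boxDeg d : ℝ) + 1) ^ 2 ≤ 1 / 2)
    (i : Fin d) {m : ℕ} (hm : 2 * m ≤ n i) (Q : Finset (Finset (BoxLabel n)) → Prop)
    (hQ : ∀ (s : ℕ) (𝒞 : Finset (Finset (BoxLabel n))), Q (𝒞.image (Finset.image (BoxLabel.rot i s))) ↔ Q 𝒞) :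
    ∑ 𝒞 ∈ ((rconnSubsets (boxSystem (G := G) ρ n).Adj Finset.univ).powerset.filter
        fun 𝒞 => ∑ Y ∈ 𝒞, (Y.card : ℝ) < m) with Q 𝒞,
        truncatedWeight (GeomInc (boxSystem (G := G) ρ n).Adj)
          (connActivity (boxSystem (G := G) ρ n).Adj (zdHaar d G) ((boxSystem (G := G) ρ n).weight β)) 𝒞 =
      (n i : ℂ) * ∑ 𝒞 ∈ ((rconnSubsets (boxSystem (G := G) ρ n).Adj Finset.univ).powerset.filter
        fun 𝒞 => ∑ Y ∈ 𝒞, (Y.card : ℝ) < m) with Q 𝒞 ∧ BoxRooted i m 𝒞,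
        truncatedWeight (GeomInc (boxSystem (G := G) ρ n).Adj)
          (connActivity (boxSystem (G := G) ρ n).Adj (zdHaar d G) ((boxSystem (G := G) ρ n).weight β)) 𝒞 := by
  set T := boxSystem (G := G) ρ n with hT
  set L := rconnSubsets T.Adj Finset.univ with hL
  set Sm := L.powerset.filter fun 𝒞 => ∑ Y ∈ 𝒞, (Y.card : ℝ) < m with hSm
  set Φ : Finset (Finset (BoxLabel n)) → ℂ := truncatedWeight (GeomInc T.Adj)
    (connActivity T.Adj (zdHaar d G) (T.weight β)) with hΦ
  set rotF : ℕ → Finset (Finset (BoxLabel n)) → Finset (Finset (BoxLabel n)) :=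
    fun s 𝒞 => 𝒞.image (Finset.image (BoxLabel.rot i s)) with hrotF
  have hR := boxSystem_regular (d := d) (G := G) ρ hρ n
  -- the truncated functional vanishes off nonempty clusters
  have hKP : IsKPVolume (GeomInc T.Adj) (connActivity T.Adj (zdHaar d G) (T.weight β)) (fun X => (X.card : ℝ)) L :=
    isKPVolume_connActivity (R := T.Adj) hR.card_near_le (fun x y h => T.mem_near x y h)
      (PlaqSystem.isLocalPerturbation hR hβ) hsmall L
  set P : Finset (Finset (BoxLabel n)) → Prop := fun 𝒞 => IsPolymerCluster (GeomInc T.Adj) 𝒞 ∧ 𝒞.Nonempty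
    with hP
  have hΦ0 : ∀ 𝒞 ∈ Sm, ¬ P 𝒞 → Φ 𝒞 = 0 := by
    intro 𝒞 h𝒞 hnP
    have h𝒞L : 𝒞 ⊆ L := Finset.mem_powerset.1 (Finset.mem_filter.1 h𝒞).1
    by_cases hcl : IsPolymerCluster (GeomInc T.Adj) 𝒞
    · have hempty : 𝒞 = ∅ := Finset.not_nonempty_iff_eq_empty.1 fun hne => hnP ⟨hcl, hne⟩
      rw [hempty, hΦ, truncatedWeight_empty]
    · exact truncatedWeight_eq_zero_of_kp hKP h𝒞L hcl
  -- restrict both sums to nonempty clusters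
  have hrestrict : ∀ (R' : Finset (Finset (BoxLabel n)) → Prop) [DecidablePred R'],
      ∑ 𝒞 ∈ Sm with R' 𝒞, Φ 𝒞 = ∑ 𝒞 ∈ (Sm.filter R') with P 𝒞, Φ 𝒞 := by
    intro R' _
    rw [← Finset.sum_filter_add_sum_filter_not (Sm.filter R') P, add_eq_left]
    exact Finset.sum_eq_zero fun 𝒞 h𝒞 => hΦ0 𝒞 (Finset.mem_filter.1 (Finset.mem_filter.1 h𝒞).1).1
      (Finset.mem_filter.1 h𝒞).2
  rw [hrestrict Q, hrestrict fun 𝒞 => Q 𝒞 ∧ BoxRooted i m 𝒞]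
  set A := (Sm.filter Q).filter P with hA
  set Ar := (Sm.filter fun 𝒞 => Q 𝒞 ∧ BoxRooted i m 𝒞).filter P with hAr
  -- invariance of `Sm`, `Q`, `P` under rotations
  have hL_rot : ∀ (s : ℕ) (Y : Finset (BoxLabel n)), Y.image (BoxLabel.rot i s) ∈ L ↔ Y ∈ L :=
    fun s Y => image_rot_mem_rconnSubsets_iff (G := G) (ρ := ρ) i s Y
  have hSm_rot : ∀ (s : ℕ) (𝒞 : Finset (Finset (BoxLabel n))), rotF s 𝒞 ∈ Sm ↔ 𝒞 ∈ Sm := by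
    intro s 𝒞
    simp only [hSm, Finset.mem_filter, Finset.mem_powerset, hrotF, sum_card_rotFamily]
    refine and_congr_left fun _ => ⟨fun h Y hY => ?_, fun h Y' hY' => ?_⟩
    · exact (hL_rot s Y).1 (h (Finset.mem_image_of_mem _ hY))
    · obtain ⟨Y, hY, rfl⟩ := Finset.mem_image.1 hY'
      exact (hL_rot s Y).2 (h hY)
  have hP_rot : ∀ (s : ℕ) (𝒞 : Finset (Finset (BoxLabel n))), P (rotF s 𝒞) ↔ P 𝒞 := by
    intro s 𝒞
    simp only [hP, hrotF, Finset.image_nonempty]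
    exact and_congr_left fun _ => isPolymerCluster_rotFamily_iff (G := G) (ρ := ρ) i s 𝒞
  have hA_rot : ∀ (s : ℕ) (𝒞 : Finset (Finset (BoxLabel n))), rotF s 𝒞 ∈ A ↔ 𝒞 ∈ A := by
    intro s 𝒞
    simp only [hA, Finset.mem_filter, hSm_rot, hP_rot]
    exact and_congr_left fun _ => and_congr_right fun _ => hQ s 𝒞
  -- the bijection `(s, 𝒞₀) ↦ rot i s 𝒞₀` from `Fin (n i) × Ar` onto `A`
  set F : Fin (n i) × Finset (Finset (BoxLabel n)) → Finset (Finset (BoxLabel n)) := fun x => rotF x.1 x.2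
    with hF
  have hArA : Ar ⊆ A := by
    intro 𝒞 h𝒞
    simp only [hAr, hA, Finset.mem_filter] at h𝒞 ⊢
    exact ⟨⟨h𝒞.1.1, h𝒞.1.2.1⟩, h𝒞.2⟩
  have himage : A = (Finset.univ ×ˢ Ar).image F := by
    ext 𝒞
    constructor
    · intro h𝒞
      have h𝒞' := h𝒞
      simp only [hA, Finset.mem_filter, hSm, Finset.mem_powerset] at h𝒞'
      obtain ⟨⟨⟨h𝒞L, hsize⟩, hQ𝒞⟩, hcl, hne⟩ := h𝒞'
      have hconn : ∀ Y ∈ 𝒞, IsRConnected T.Adj Y := fun Y hY => (mem_rconnSubsets.1 (h𝒞L hY)).2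
      obtain ⟨s, hs, hroot⟩ := exists_boxRooted_rotFamily (G := G) (ρ := ρ) i (by omega : m ≤ n i) hne hcl hconn hsize
      refine Finset.mem_image.2 ⟨(⟨s, hs⟩, rotF (n i - s) 𝒞), Finset.mem_product.2 ⟨Finset.mem_univ _, ?_⟩, ?_⟩
      · simp only [hAr, Finset.mem_filter]
        have h1 : rotF (n i - s) 𝒞 ∈ A := (hA_rot _ _).2 h𝒞
        simp only [hA, Finset.mem_filter] at h1
        exact ⟨⟨h1.1.1, h1.1.2, hroot⟩, h1.2⟩
      · show rotF s (rotF (n i - s) 𝒞) = 𝒞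
        simp only [hrotF]
        rw [rotFamily_rotFamily, Nat.add_sub_cancel' hs.le, rotFamily_size]
    · intro h𝒞
      obtain ⟨⟨s, 𝒞₀⟩, hx, rfl⟩ := Finset.mem_image.1 h𝒞
      exact (hA_rot s.1 𝒞₀).2 (hArA (Finset.mem_product.1 hx).2)
  have hinj : Set.InjOn F ((Finset.univ ×ˢ Ar : Finset (Fin (n i) × Finset (Finset (BoxLabel n)))) :
      Set (Fin (n i) × Finset (Finset (BoxLabel n)))) := by
    rintro ⟨s, 𝒞⟩ hx ⟨s', 𝒞'⟩ hx' hxx'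
    have h𝒞 := (Finset.mem_product.1 (Finset.mem_coe.1 hx)).2
    have h𝒞' := (Finset.mem_product.1 (Finset.mem_coe.1 hx')).2
    simp only [hAr, Finset.mem_filter] at h𝒞 h𝒞'
    have hss' : (s : ℕ) = s' :=
      eq_of_rotFamily_eq_of_boxRooted i hm h𝒞.1.2.2 h𝒞'.1.2.2 s.2 s'.2 hxx'
    have hs : s = s' := Fin.ext hss'
    subst hs
    exact Prod.ext rfl (rotFamily_injective i s hxx')
  have hterm : ∀ (s : Fin (n i)) (𝒞 : Finset (Finset (BoxLabel n))), Φ (F (s, 𝒞)) = Φ 𝒞 :=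
    fun s 𝒞 => truncatedWeight_rotFamily (G := G) hρ i s.1 𝒞 β
  rw [himage, Finset.sum_image hinj, Finset.sum_product,
    Finset.sum_congr rfl fun s _ => Finset.sum_congr rfl fun 𝒞 _ => hterm s 𝒞, Finset.sum_const,
    Finset.card_univ, Fintype.card_fin, nsmul_eq_mul]

end SumIdentity

end Literature.MathematicalPhysics.QuantumFieldTheory
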